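import Mathlib
import HarnessLib
import HarnessLib.Audit
import Summits.Schanuel.Statement

/-!
Route: StokesConstantPi

CLOSED (retired) 2026-08-15T13:51:31Z by operator:999:1257524 — reason: not-a-thesis: assembly does not conclude the sub-problem Statement — note: D-0027 §2.1 audit (human 2026-08-15: routes that do not decide the summit are removed): the assembly concludes `Literature.NumberTheory.Transcendental.ExpOnePiAlgebraicIndependent`, not the sub-problem statement; a NEW conforming route may be opened from the same idea (generated `closes : … → _root_. The file is kept as the record of this route; refuted decls are indexed as negative knowledge (`ledger negatives`).

# Route StokesConstantPi — pi as a Stokes constant — e ⊥ π from joint genericity of the Gaussian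
E-value and Э-value

INSTANCE route (target = the flagship instance x = (1, iπ) of Schanuel,
`Literature.NumberTheory.Transcendental.ExpOnePiAlgebraicIndependent`, kind target; not a route to
the summit). It realises the positive exit (4a) of card e-pi-obstruction-tate-gevrey. Put I := ∫₀¹
e^{-x²} dx = γ(1/2,1)/2 (an E-value: F(1) for the E-function F(z) = ∫₀¹ e^{-zx²} dx =
₁F₁(1/2;3/2;−z)) and J := ∫₀^∞ e^{-x}/√(1+x) dx = e·Γ(1/2,1) (an Э-value: the Borel–Laplace 1-sum at
z = 1 of the divergent series Σ_k (−1)^k (1/2)_k z^{-k}). Γ(1/2) = γ(1/2,1) + Γ(1/2,1) reads √π = 2I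
+ J/e (StokesIdentity): √π is the connection (Stokes) constant between the E-side and the Э-side of
one confluent hypergeometric E-operator. It suffices to show X = MixedTripleIndependent: e, I, J are
algebraically independent over ℚ. Since ℚ(e, I, J) = ℚ(e, I, √π), X ⟺ (e, π, I) algebraically
independent (StokesSplit) ⟹ e ⊥ π (drop I).
Lean: `AlgebraicIndependent ℚ ![Real.exp 1, ∫ x in (0:ℝ)..1, Real.exp (-x ^ 2), ∫ x in Set.Ioi
(0:ℝ), Real.exp (-x) / Real.sqrt (1 + x)]`

## Assembly
Bookkeeping, proved sorry-free in the planner sketch (axioms propext/Classical.choice/Quot.sound):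
from MixedTripleIndependent and StokesSplit get AlgebraicIndependent ℚ ![e, π, I]; compose with the
injection ![0,1] : Fin 2 → Fin 3 (`AlgebraicIndependent.comp`) to get ![e, π], which is
`ExpOnePiAlgebraicIndependent` by `rfl`.

Rationale: WHY THIS LINE. E-function methods (Siegel–Shidlovskii, PROVED in the tree as
`Literature.Barriers.Schanuel.siegelShidlovskii_algIndep_holds`) reach e but not π, because π is not
an E-value at an algebraic point (barrier EFunctionValuesAtAlgebraicPoints); but √π IS the Stokes
constant linking the basis at 0 (E-functions) to the basis at ∞ (Э-series) of the same E-operator: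
for F(z) = ∫₀¹e^{-zx²}dx and H(z) = ∫₀^∞ e^{-x}(1+x/z)^{-1/2}dx one has 2zF(z) + e^{-z}H(z) = √(πz),
and the vector Y = (1, e^{-z}, F, H) solves Y′ = A(z)Y with A ∈ M₄(ℚ(z)) (F′ = (e^{-z} − F)/(2z), H′
= (1 + 1/(2z))H − 1), regular at z = 1, θ = 0 not anti-Stokes. Over ℂ(z) the functions (e^{-z}, F,
H) have transcendence degree 2, over ℚ̄(z) they have degree 3 — exactly because π ∉ ℚ̄
(FunctionalIndependence, provable from the tree's Lindemann `transcendental_pi_holds`): so the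
Siegel–Shidlovskii/Beukers equality "trdeg over ℚ̄ of the values at an algebraic point = trdeg over
ℚ̄(z) of the functions", extended from E-functions to this MIXED E/Э system, converts Lindemann's
theorem into e ⊥ π. Imported areas: Siegel–Shidlovskii–Beukers (E-functions), André's arithmetic
Gevrey series (Andre2000GevreyI, Andre2000GevreyII) and the Fischler–Rivoal programme on the rings
E, G, D of E-, G-, Э-values (FischlerRivoal2024 = arXiv:2301.13518: Conj. 1–3, Thm 4 = linear
independence of mixed values under Conj. 3, Cor. 1 = transcendence of ∫₀^∞(t+α)^s e^{-t}dt under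
Conj. 2), Rivoal2012 (Thm 2: two of e^z, Γ(α)z^{-α}, 𝒢_α(z) are algebraically independent — our "2
of 3" at α = 1/2, z = 1), Borel–Laplace summation (resurgence). What it does that the other Schanuel
routes do not: its whole import cone is PROVED (Siegel–Shidlovskii, Lindemann), every item is a
statement about values at z = 1 of solutions of ONE linear ODE over ℚ(z), and two rungs (linear,
single Э-value) are exactly where the only existing conjectural technology (Fischler–Rivoal) bites.
Negatives index: empty at filing.

RANKED CRUXES. #0 EPi (target) — e and π are algebraically independent over ℚ (Schanuel at (1, iπ));
the existing Literature open statement. (why it might fail: it is Schanuel's flagship open instance;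
false iff some P ∈ ℤ[x,y]∖0 has P(e,π) = 0 — no evidence either way beyond numerics.) [BakerTNT1975,
Waldschmidt2000, BaysKirby2018ANT]
#2 MixedTripleIndependent (crux) — e, I = ∫₀¹e^{-x²}dx (Gaussian E-value) and J =
∫₀^∞e^{-x}/√(1+x)dx (Gaussian Э-value) are algebraically independent over ℚ; equivalently trdeg ℚ(e,
π, ∫₀¹e^{-x²}) = 3 (card item C1; completes Rivoal2012 Thm 2 "two of e^z, Γ(α)z^{-α}, 𝒢_α(z)" at α =
1/2, z = 1). [difficulty: open-problem] (why it might fail: formally STRONGER than e ⊥ π (adds an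
E-value); fails iff √π ∈ acl ℚ(e, ∫₀¹e^{-x²}); no conjecture in print covers products of mixed
values (Fischler–Rivoal: "no hope … transcendence degree" by their method).) [Rivoal2012,
FischlerRivoal2024, arXiv:2301.13518, Shidlovskii1989]
#3 MixedLinearIndependence (crux) — LINEAR RUNG — 1, e⁻¹, I, J are linearly independent over ℚ̄: the
Fischler–Rivoal Theorem 4 conclusion for the mixed system (1, e^{-z}, F, H) at z = 1
(FischlerRivoal2024, there conditional on their Conjecture 3); given Shidlovskii's pair it says
exactly J = e·Γ(1/2,1) ∉ ℚ̄ + ℚ̄e⁻¹ + ℚ̄·∫₀¹e^{-x²}. Ladder: MixedTripleIndependent ⇒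
MixedLinearIndependence ⇒ AntiEValueTranscendental. [difficulty: open-problem] (why it might fail:
in print only under Fischler–Rivoal Conj. 3 (mixed Beukers), open even in rank one (Conj. 2); false
iff J ∈ ℚ̄ + ℚ̄e⁻¹ + ℚ̄∫₀¹e^{-x²} — nothing known excludes it.) [FischlerRivoal2024,
arXiv:2301.13518, Rivoal2012]
#4 AntiEValueTranscendental (crux) — Э-RUNG — the single Э-value J = ∫₀^∞ e^{-x}/√(1+x) dx =
e·Γ(1/2,1) is transcendental (Fischler–Rivoal Cor. 1 at s = −1/2, α = 1, there conditional on Conj.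
2; the s = −1 sibling is Gompertz's constant, irrationality open). [difficulty: open-problem] (why
it might fail: J = e(√π − 2∫₀¹e^{-x²}) could be algebraic without contradicting any theorem;
unconditionally not even irrationality of such 1-sums (e.g. Gompertz δ) is known; Conj. 2 itself may
fail for some Э-function.) [FischlerRivoal2024, arXiv:2301.13518, arXiv:2508.12123,
Lagarias2013EulerConstant]
#9 StokesIdentity (support) — √π = 2∫₀¹e^{-x²}dx + e⁻¹∫₀^∞e^{-x}/√(1+x)dx (Γ(1/2) = √π split at 1; t
= x², t = 1 + x). [difficulty: provable-now] [Mathlib:Real.Gamma_one_half_eq, arXiv:2301.13518]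
#9 StokesSplit (support) — MixedTripleIndependent ↔ (e, π, ∫₀¹e^{-x²}dx) algebraically independent
(ℚ(e, I, J) = ℚ(e, I, √π); √π ↔ π). [difficulty: provable-now] [Mathlib:AlgebraicIndependent,
arXiv:2301.13518]
#9 ShidlovskiiPair (support) — KNOWN ("2 of 3"): e and ∫₀¹e^{-x²}dx are algebraically independent —
Shidlovskii's theorem for the Kummer function ₁F₁(1;3/2;z) (F(z) = e^{-z}₁F₁(1;3/2;z)); in the tree:
apply the PROVED `Literature.Barriers.Schanuel.siegelShidlovskii_algIndep_holds` to the strict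
E-functions (e^{-z}, F), system 2zF′ = e^{-z} − F, α = 1, after proving (z, e^{-z}, F) algebraically
independent over ℚ̄ as functions. [difficulty: L] [Shidlovskii1989, Rivoal2012, Rivoal2024,
Mahler1968]
#9 FunctionalIndependence (support) — the FUNCTIONAL side is algebraically independent over ℚ̄
although dependent over ℂ(z) (2zF + e^{-z}H = √(πz)): no nonzero polynomial with algebraic
coefficients vanishes identically on (0,∞) at (z, e^{-z}, F(z), H(z)); proof = ℂ-independence of (z,
e^{-z}, F) (classical) + π ∉ ℚ̄ (tree
`Literature.NumberTheory.Transcendental.transcendental_pi_holds`) + the descent argument of NOTES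
(specialise the free constant c = √π). [difficulty: M] [Lindemann1882, FischlerRivoal2024,
Shidlovskii1989]

TWO-LAYER PLAN. Foreseen glued splits (k ≤ 3, depth 1), filed only when something lands: (i)
MixedTripleIndependent ⇐ MixedTransferAtOne → FunctionalIndependence → MixedTripleIndependent, where
MixedTransferAtOne is the Beukers-shaped transfer "every ℚ̄-algebraic relation among (e⁻¹, F(1),
H(1)) is the value at z = 1 of a ℚ̄[z]-relation among (e^{-z}, F, H)" (typed like
FunctionalIndependence; it is the mixed Siegel–Shidlovskii principle at this system, the item a
transcendence prover actually attacks); (ii) MixedLinearIndependence ⇐ (Fischler–Rivoal Conj. 3 for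
the ℚ̄[z]-span of (1, e^{-z}, F, H)) → (ℚ̄(z)-linear independence of (1, e^{-z}, F, H), provable) →
MixedLinearIndependence; (iii) AntiEValueTranscendental ⇐ (Conj. 2 for the Э-series Σ(−1)^k(1/2)_k
k!·x^k/k!) → (non-polynomiality, trivial) → AntiEValueTranscendental. ShidlovskiiPair may split as
(strictness + system) → (functional independence of z, e^{-z}, F over ℚ̄) → pair via
`siegelShidlovskii_algIndep_holds`.

KILL CRITERIA. MixedTripleIndependent refuted by a relation NOT involving ∫₀¹e^{-x²} ⇒ ¬EPi ⇒
Schanuel refuted (every route closes). Refuted by a relation involving it, or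
AntiEValueTranscendental refuted (J ∈ ℚ̄ kills all three cruxes) ⇒ `close --reason
refuted:MixedTripleIndependent` — the Stokes-side line is dead, EPi untouched. A mixed E/Э system
elsewhere with functions independent over ℚ̄(z) but algebraically dependent values refutes the
general transfer principle ⇒ pivot: restrict MixedTransferAtOne to systems whose ℂ(z)-relations have
period coefficients, re-rank the linear rung first. EPi proved by another route ⇒ close superseded
(MixedTripleIndependent stays open as a Literature question).

NOT DECOMPOSED YET. The general mixed Siegel–Shidlovskii principle for vectors of E-functions and
1-summed Э-functions (needs the Э definitions requested below); quantitative measures; the sibling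
triples (e, Γ(α), γ(α,1)) for α = 1/3, 1/4 (meeting Chudnovsky/Nesterenko) and the α = 0 analogue
(e, Euler's γ, Gompertz's δ); Hermite–Padé engines (Rivoal2012) for the linear rung; the card's
negative items — the mixed-Gevrey auxiliary-polynomial cap (B1) and the finite-type transfer
computation at q = 1/e (N1) — which are refuter-side analyses, not items.

CHEAPEST FALSIFIER. Integer-relation search (PSLQ/LLL at 80 digits) among the 35 monomials of degree
≤ 4 in (e, π, ∫₀¹e^{-x²}dx) and among (1, e⁻¹, I, J): any relation of height < 10¹² kills
MixedTripleIndependent (resp. MixedLinearIndependence) — a one-minute kit job for a refuter (not run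
here: the hub is compute-free and mpmath is absent locally; only the identity √π = 2I + J/e was
checked numerically to 1e-13). Lookup falsifier: an unconditional proof in print of the
transcendence of ∫₀^∞e^{-t}(t+1)^{-1/2}dt or of the ℚ̄-linear independence of (1, e⁻¹, I, J) would
downgrade cruxes 3–4 to support — searched (zbMATH "Gompertz constant transcendence",
Fischler–Rivoal 2024 pp. 3–6, 10–11, Powers arXiv:2508.12123/2510.00315): conditional results only.

NUMBERS. I = ∫₀¹e^{-x²}dx = 0.7468241328…, J = ∫₀^∞e^{-x}/√(1+x)dx = 0.7578721561…, 2I + J/e =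
1.7724538509… = √π. Known: trdeg ℚ(e, I) = 2 (Shidlovskii; Rivoal2012 Thm 2 gives trdeg ℚ(e, √π, J)
≥ 2 for every α ∈ ℚ∖ℤ, z ∈ ℚ̄∖ℝ≤0); π ∉ ℚ̄ (tree, proved); functional trdeg of (e^{-z}, F, H): 2
over ℂ(z), 3 over ℚ̄(z). Conjectured here: trdeg ℚ(e, I, J) = 3. Items at open: 9 (1 target, 3
cruxes, 4 support, 1 assembly).

DEFINITION REQUESTS. Notion `AntiEFunction` (topic Literature/NumberTheory/Transcendental): for
E-coefficients a (tree `Literature.Barriers.Schanuel.IsStrictEFunction a`, F = Σ aₙzⁿ/n!) the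
Э-series 𝔣_a(x) = Σ n!·aₙ·xⁿ (André 2000; Fischler–Rivoal arXiv:2301.13518 §1), its Borel–Laplace
1-sum in a non-anti-Stokes direction θ, 𝔣_{a,θ}(1/z) = ∫₀^{∞e^{iθ}} e^{-t} G_a(t/z) dt with G_a the
analytic continuation of the G-function Σ aₙξⁿ along the ray, and the ring of Э-values `antiEValues`
(F–R's D); wanted so that Fischler–Rivoal Conj. 1–3 and the general mixed Siegel–Shidlovskii
principle (split (i) above in general form) become typed open statements. No cite facts needed:
Siegel–Shidlovskii and Lindemann are proved in the tree.

Novelty: Searches (2026-08-15): `lit search --hybrid "algebraic independence of e and the integral of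
exp(-x^2) Shidlovskii E-functions"` (8 books: Baker1975 Ch. 11, NP2001, Chudnovsky1984 — no mixed
values); `lit search --source zbmath "Shidlovskii algebraic independence values E-functions"` (10),
`… "Gompertz constant Euler constant transcendence" --reviews` (5: Rivoal2012 review by Waldschmidt
quoting Thm 1–2; Powers 2025–26 preprints: γ, δ irrationality open); `lit read arxiv:2301.13518` pp.
2–6, 10–11 (Conj. 1–3, Thm 1, 3, 4, Cor. 1, Prop. 1; "no hope … transcendence degree" for mixed
products); `lit frontier Schanuel --since 2020` (30; only arXiv:2601.18474 on Γ-derivatives nearby),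
`lit bridges Schanuel --cross any` (30, none on E/Э values), `lit galaxy search "Gompertz's
constant" --star all` (2: Finch's constants book); card audit (refuter-novelty-audit 2026-08-15: F–R
never mention e, π or Schanuel). Rivoal2012 full text paywalled (acq-02224).
Nearest prior art found: Rivoal2012 = doi:10.1307/mmj/1339011525 (Thm 2: two of e^z, Γ(α)z^{-α},
𝒢_α(z) algebraically independent — the triple and "2 of 3"), FischlerRivoal2024 = arXiv:2301.13518
(E/D rings, mixed functions, conditional linear independence and Э-transcendence), Mahler1968
(applications of Shidlovskii's theorem to such functions), Andre2000GevreyI/II (E-operators, duality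
E ↔ Э, 'transcendance sans transcendance').
Delta: nobody in the searched literature poses "all three" at α = 1/2 as the Stokes-side form of e ⊥
π, no  [refs: 10.1307/mmj/1339011525, 2301.13518, 2601.18474, arxiv:2301.13518, doi:10.1307/mmj/1339011525, Baker1975, Chudnovsky1984, Rivoal2012, FischlerRivoal2024, Mahler1968]

Barriers (technique_class: siegel-shidlovskii e-functions anti-e-functions stokes): - technique_class: siegel-shidlovskii e-functions anti-e-functions stokes
- Literature.Barriers.Schanuel.EFunctionValuesAtAlgebraicPoints: engaged head-on and evaded by
enlarging the class of functions, not the class of points: every number in the route (e, I, J) IS a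
value at the algebraic point z = 1 of a solution of a linear ODE over ℚ(z); π enters only as the
Stokes constant √π = 2I + J/e, i.e. through the 1-summed Э-solution H, which is outside the
barrier's explicit class (strict E-functions, `eValues`) — the bet is that Siegel's arithmetic
transfer survives for the mixed system although mixed products are not a ring (Fischler–Rivoal's
stated obstruction).
- Literature.Barriers.Schanuel.AxSchanuelFunctionalNotNumerical: the functional input here is not
Ax–Schanuel/E-derivations (which vanish on ecl ∅ ∋ e, π) but the ARITHMETIC of Taylor/asymptotic
coefficients (E- and Э-conditions) plus FunctionalIndependence over ℚ̄(z); the transfer functional →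
numerical is Siegel–Shidlovskii-type, which the barrier file itself names as the one functional
method that does yield numbers.
- Literature.Barriers.Schanuel.NesterenkoModularScope: not used — no modular/q-series input; the
card's Tate-curve reading (Nesterenko at q = 1/e gives 3 of 5 invariants) is context explaining why
the modular corner cannot see (e, π), not an ingredient.
- Literature.Barriers.Schanuel.PeriodConjectureOverQbarScope: consistent — e, √π, I, J are
EXPONENTIAL periods over ℚ̄ (∫ e^{-f}·algebraic form), not p

History (route lifecycle, newest last):
- 2026-08-15T13:51:31Z · CLOSED retired — not-a-thesis: assembly does not conclude the sub-problem Statement (operator:999:1257524)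

sub-problem: Schanuel · status: closed(retired) · opened planner-plancard-Schanuel-Schanuel-e-pi-obstr-991047b5-0 2026-08-15T11:23:25Z · rev 0 · ledger route-Schanuel-StokesConstantPi
GENERATED by the gate from the ledger (D-0016/17). Provers cite these decls: `theorem foo : Summit.Schanuel.Schanuel.Theses.StokesConstantPi.<Decl> := …` in Summits/Schanuel/Schanuel/Theorems/<Name>.lean.
-/

namespace Summit.Schanuel.Schanuel.Theses.StokesConstantPi

open scoped BigOperators Topology Manifold Classical MeasureTheory ProbabilityTheory Matrix InnerProductSpace ComplexConjugate ContinuousMap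
open Filter Set Function TopologicalSpace MeasureTheory

attribute [summit_statement] _root_.Schanuel

open Literature.Periods

/-- item stmt-Schanuel-3724 · target · rank 0 · closed · moot by None · by planner
why it might fail: it is Schanuel's flagship open instance; false iff some P ∈ ℤ[x,y]∖0 has P(e,π) = 0 — no evidence either way beyond numerics.
sources: BakerTNT1975, Waldschmidt2000, BaysKirby2018ANT
[target] e and π are algebraically independent over ℚ (Schanuel at (1, iπ)); the existing Literature
open statement. -/
@[route_item "route-Schanuel-StokesConstantPi"]
def EPi : Prop :=
  Literature.NumberTheory.Transcendental.ExpOnePiAlgebraicIndependent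

/-- item stmt-Schanuel-3725 · crux · rank 2 · closed · moot by None · by planner
why it might fail: formally STRONGER than e ⊥ π (adds an E-value); fails iff √π ∈ acl ℚ(e, ∫₀¹e^{-x²}); no conjecture in print covers products of mixed values (Fischler–Rivoal: "no hope … transcendence degree" by their method).
sources: Rivoal2012, FischlerRivoal2024, arXiv:2301.13518, Shidlovskii1989
[crux] e, I = ∫₀¹e^{-x²}dx (Gaussian E-value) and J = ∫₀^∞e^{-x}/√(1+x)dx (Gaussian Э-value) are
algebraically independent over ℚ; equivalently trdeg ℚ(e, π, ∫₀¹e^{-x²}) = 3 (card item C1;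
completes Rivoal2012 Thm 2 "two of e^z, Γ(α)z^{-α}, 𝒢_α(z)" at α = 1/2, z = 1). [difficulty:
open-problem] -/
@[route_item "route-Schanuel-StokesConstantPi"]
def MixedTripleIndependent : Prop :=
  AlgebraicIndependent ℚ ![Real.exp 1, ∫ x in (0:ℝ)..1, Real.exp (-x ^ 2), ∫ x in Set.Ioi (0:ℝ), Real.exp (-x) / Real.sqrt (1 + x)]

/-- item stmt-Schanuel-3726 · crux · rank 3 · closed · moot by None · by planner
why it might fail: in print only under Fischler–Rivoal Conj. 3 (mixed Beukers), open even in rank one (Conj. 2); false iff J ∈ ℚ̄ + ℚ̄e⁻¹ + ℚ̄∫₀¹e^{-x²} — nothing known excludes it.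
sources: FischlerRivoal2024, arXiv:2301.13518, Rivoal2012
[crux] LINEAR RUNG — 1, e⁻¹, I, J are linearly independent over ℚ̄: the Fischler–Rivoal Theorem 4
conclusion for the mixed system (1, e^{-z}, F, H) at z = 1 (FischlerRivoal2024, there conditional on
their Conjecture 3); given Shidlovskii's pair it says exactly J = e·Γ(1/2,1) ∉ ℚ̄ + ℚ̄e⁻¹ +
ℚ̄·∫₀¹e^{-x²}. Ladder: MixedTripleIndependent ⇒ MixedLinearIndependence ⇒ AntiEValueTranscendental.
[difficulty: open-problem] -/
@[route_item "route-Schanuel-StokesConstantPi"]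
def MixedLinearIndependence : Prop :=
  ∀ a b c d : ℝ, IsAlgebraic ℚ a → IsAlgebraic ℚ b → IsAlgebraic ℚ c → IsAlgebraic ℚ d → a + b * Real.exp (-1) + c * (∫ x in (0:ℝ)..1, Real.exp (-x ^ 2)) + d * (∫ x in Set.Ioi (0:ℝ), Real.exp (-x) / Real.sqrt (1 + x)) = 0 → a = 0 ∧ b = 0 ∧ c = 0 ∧ d = 0

/-- item stmt-Schanuel-3727 · crux · rank 4 · closed · moot by None · by planner
why it might fail: J = e(√π − 2∫₀¹e^{-x²}) could be algebraic without contradicting any theorem; unconditionally not even irrationality of such 1-sums (e.g. Gompertz δ) is known; Conj. 2 itself may fail for some Э-function.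
sources: FischlerRivoal2024, arXiv:2301.13518, arXiv:2508.12123, Lagarias2013EulerConstant
[crux] Э-RUNG — the single Э-value J = ∫₀^∞ e^{-x}/√(1+x) dx = e·Γ(1/2,1) is transcendental
(Fischler–Rivoal Cor. 1 at s = −1/2, α = 1, there conditional on Conj. 2; the s = −1 sibling is
Gompertz's constant, irrationality open). [difficulty: open-problem] -/
@[route_item "route-Schanuel-StokesConstantPi"]
def AntiEValueTranscendental : Prop :=
  Transcendental ℚ (∫ x in Set.Ioi (0:ℝ), Real.exp (-x) / Real.sqrt (1 + x))

/-- item stmt-Schanuel-3728 · support · rank 9 · closed · moot by None · by planner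
sources: Mathlib:Real.Gamma_one_half_eq, arXiv:2301.13518
[support] √π = 2∫₀¹e^{-x²}dx + e⁻¹∫₀^∞e^{-x}/√(1+x)dx (Γ(1/2) = √π split at 1; t = x², t = 1 + x).
[difficulty: provable-now] -/
@[route_item "route-Schanuel-StokesConstantPi"]
def StokesIdentity : Prop :=
  Real.sqrt Real.pi = 2 * (∫ x in (0:ℝ)..1, Real.exp (-x ^ 2)) + Real.exp (-1) * ∫ x in Set.Ioi (0:ℝ), Real.exp (-x) / Real.sqrt (1 + x)

/-- item stmt-Schanuel-3729 · support · rank 9 · closed · moot by None · by planner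
sources: Mathlib:AlgebraicIndependent, arXiv:2301.13518
[support] MixedTripleIndependent ↔ (e, π, ∫₀¹e^{-x²}dx) algebraically independent (ℚ(e, I, J) = ℚ(e,
I, √π); √π ↔ π). [difficulty: provable-now] -/
@[route_item "route-Schanuel-StokesConstantPi"]
def StokesSplit : Prop :=
  AlgebraicIndependent ℚ ![Real.exp 1, ∫ x in (0:ℝ)..1, Real.exp (-x ^ 2), ∫ x in Set.Ioi (0:ℝ), Real.exp (-x) / Real.sqrt (1 + x)] ↔ AlgebraicIndependent ℚ ![Real.exp 1, Real.pi, ∫ x in (0:ℝ)..1, Real.exp (-x ^ 2)]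

/-- item stmt-Schanuel-3730 · support · rank 9 · closed · moot by None · by planner
sources: Shidlovskii1989, Rivoal2012, Rivoal2024, Mahler1968
[support] KNOWN ("2 of 3"): e and ∫₀¹e^{-x²}dx are algebraically independent — Shidlovskii's theorem
for the Kummer function ₁F₁(1;3/2;z) (F(z) = e^{-z}₁F₁(1;3/2;z)); in the tree: apply the PROVED
`Literature.Barriers.Schanuel.siegelShidlovskii_algIndep_holds` to the strict E-functions (e^{-z},
F), system 2zF′ = e^{-z} − F, α = 1, after proving (z, e^{-z}, F) algebraically independent over ℚ̄
as functions. [difficulty: L] -/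
@[route_item "route-Schanuel-StokesConstantPi"]
def ShidlovskiiPair : Prop :=
  AlgebraicIndependent ℚ ![Real.exp 1, ∫ x in (0:ℝ)..1, Real.exp (-x ^ 2)]

/-- item stmt-Schanuel-3731 · support · rank 9 · closed · moot by None · by planner
sources: Lindemann1882, FischlerRivoal2024, Shidlovskii1989
[support] the FUNCTIONAL side is algebraically independent over ℚ̄ although dependent over ℂ(z) (2zF
+ e^{-z}H = √(πz)): no nonzero polynomial with algebraic coefficients vanishes identically on (0,∞)
at (z, e^{-z}, F(z), H(z)); proof = ℂ-independence of (z, e^{-z}, F) (classical) + π ∉ ℚ̄ (tree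
`Literature.NumberTheory.Transcendental.transcendental_pi_holds`) + the descent argument of NOTES
(specialise the free constant c = √π). [difficulty: M] -/
@[route_item "route-Schanuel-StokesConstantPi"]
def FunctionalIndependence : Prop :=
  ∀ P : MvPolynomial (Fin 4) ℝ, (∀ m, IsAlgebraic ℚ (P.coeff m)) → (∀ z : ℝ, 0 < z → MvPolynomial.eval ![z, Real.exp (-z), ∫ x in (0:ℝ)..1, Real.exp (-(z * x ^ 2)), ∫ x in Set.Ioi (0:ℝ), Real.exp (-x) / Real.sqrt (1 + x / z)] P = 0) → P = 0

/-- item stmt-Schanuel-3732 · assembly · rank 1 · closed · moot by None · by planner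
sources: BakerTNT1975, arXiv:2301.13518
[assembly] MixedTripleIndependent → StokesSplit → ExpOnePiAlgebraicIndependent. -/
@[route_item "route-Schanuel-StokesConstantPi"]
def Assembly : Prop :=
  MixedTripleIndependent → StokesSplit → Literature.NumberTheory.Transcendental.ExpOnePiAlgebraicIndependent

end Summit.Schanuel.Schanuel.Theses.StokesConstantPi
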